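import Literature.MathematicalPhysics.QuantumFieldTheory.King1986.MinimizerAliasModes
import HarnessLib

/-!
# BalabanUVNodes ∕ N15 — THE KING-MODEL RUNG (PART Ϡ-a): KING's (4.3)–(4.4) AT `η = 0` — THE CONTINUUM BLOCK FORM FACTOR `u⁰(p) = Π_μ (e^{−ip_μ} − 1)∕(−ip_μ)`
# AND THE CONTINUUM SYMBOL `|p|² + m²`, WITH THE RATES `‖u^η(p) − u⁰(p)‖ ≤ η·(Σ_μ|p_μ|)·‖u^η(p)‖`, `|Δ^η(p) − (|p|² + m²)| ≤ (η²∕12)Σ_μ p_μ⁴` ON THE ZONE, AND THE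
# LIMITS `u^η(p) → u⁰(p)`, `Δ^η(p) → |p|² + m²` AS `η → 0⁺`
# (Track A, DAG node N15 = NE2; FAN-OUT v1.1 §N15 s3 «KING-MODEL RUNG … NE2's analogue DECIDED in the model»)

HONEST FRAMING.  Count-neutral (cell `pub-ymgap`, seat `pub-ymgap-dag-n15-e` g32; `--supports stmt-QuantumFields-27366 --as helper` = K3⁸
`SpineGivenEndpointR13SepCoPHV`).  TEMPLATE LITERATURE: C. King, *The U(1) Higgs model. I. The continuum limit*, Commun. Math. Phys. **102** (1986) 649–677
[King1986] — KING's OWN `A = 0` MODEL in momentum variables: the averaging weight `u^η_k(p) = Π_μ (e^{−ip_μ} − 1)η(e^{−iηp_μ} − 1)⁻¹` ((4.3) p. 670; tree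
`King1986.uWeight η p`, one factor `uFac η x = (e^{−ix} − 1)∕D_η(x)`, `D_η(x) = fdq η x = η⁻¹(e^{−iηx} − 1)`) and the fine symbol `Δ^η(p) = 4η⁻²Σ_μ sin²(½ηp_μ) +
m²(L^kε)²` ((4.4); tree `King1986.latticeSymbol η M p`, `momSq p = Σ_μ p_μ²`).  NOT Bałaban's objects; NOT a node discharge (N15 is booked through n15-a's knit,
untouched here); nothing continuum-Yang–Mills ∕ ℝ⁴ ∕ OS ∕ mass-gap ∕ Clay.  0 `sorry`; standard axioms.

WHY (the door of g32, PART Ϡ).  King's (4.5) `Δ^{(k)}(p′) = (a_k⁻¹ + Σ_l |u^η_k(p′+l)|²Δ^η(p′+l)⁻¹)⁻¹` carries the fine spacing `η = L^{−k}` only through the two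
letters of this file; their `η → 0⁺` limits are the elementary facts `η⁻¹(e^{−iηx} − 1) → −ix` and `4η⁻²sin²(½ηx) → x²`.  The tree has the TWO-SPACING rates
(Lemma 4.4 (4.29) `King1986.lemma44`, (4.25) `norm_fdq_sub_fdq_le`, (4.7)∕(4.10) `latticeSymbol_ge_quartic`) between two positive spacings `η, η′`, never the
`η′ = 0` endpoint; this file types the endpoint objects and the same rates against them, so that parts Ϡ-b∕Ϡ-c can pass to the `K → ∞` limit of the alias sum
and of `Δ^{(K)}` (the continuum form of (4.5)), and Ϡ-d∕Ϡ-e to the limit of NE2's unit-layer kernel `(Δ^{(K)})⁻¹(b, b′)` of the rung.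

WHAT THIS FILE PROVES (kernel; Mathlib + `King1986/AveragingWeightRate`, `…/EffectiveLaplacianRate`, `…/MinimizerAliasModes` by name).
§1 `fdq0 q = −iq` (the `η = 0` difference symbol), `‖fdq0 q‖ = |q|`, ★ **`norm_fdq_sub_fdq0_le`** (`‖D_η(q) − (−iq)‖ ≤ η·q²`, all `η > 0`, all real `q`; the
integral representation `D_η(q) = (−iq)∫₀¹e^{−iηqs}ds` of the tree against `−iq = (−iq)∫₀¹1`, `|e^{ia} − 1| ≤ |a|`), ★ `tendsto_fdq_zero` (`D_η(q) → −iq` as `η → 0⁺`).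
§2 `uFac0 x = (e^{−ix} − 1)∕(−ix)` (filled by `1` at `x = 0`), `‖uFac0 x‖ ≤ 1`, the comparability `‖uFac0 x‖ ≤ ‖uFac η x‖` on the zone `|ηx| ≤ π`, the exact
relative-error identity `uFac η x − uFac0 x = uFac η x·(D₀ − D_η)∕D₀`, ★★ **`norm_uFac_sub_uFac0_le`** (`‖f_η(x) − f₀(x)‖ ≤ η|x|·‖f_η(x)‖` on the zone — Lemma 4.4's
one-coordinate step at `η′ = 0`), ★ `tendsto_uFac_zero`.
§3 `uWeight0 p = Π_μ uFac0 (p_μ)` (= `u⁰(p)`), `‖u⁰(p)‖ ≤ 1`, ★★ **`norm_uWeight_sub_uWeight0_le`** (`‖u^η(p) − u⁰(p)‖ ≤ η(Σ_μ|p_μ|)·‖u^η(p)‖` on the zone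
`|ηp_μ| ≤ π` — (4.29) with `γ = 1`, constant `1`, at the endpoint `η′ = 0`; King's product telescoping `norm_prod_sub_prod_le_rel` with `K = 1`),
★★ **`tendsto_uWeight_zero`** (`u^η(p) → u⁰(p)` as `η → 0⁺`, every `p`).
§4 `mass_le_latticeSymbol` (`m² ≤ Δ^η(p)`), ★ **`abs_latticeSymbol_sub_le`** (`|Δ^η(p) − (|p|² + m²)| ≤ (η²∕12)Σ_μ p_μ⁴` on the zone — (4.10) two-sided),
★★ **`tendsto_latticeSymbol_zero`** (`Δ^η(p) → |p|² + m²` as `η → 0⁺`).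

HONEST SCOPE.  Elementary real∕complex analysis of King's printed letters (4.3)–(4.4) at the endpoint `η = 0`; every constant explicit; nothing is claimed about
Bałaban's covariant averaging operators (no plane-wave representation there).  N15 untouched; counts unmoved.
Locators: [King1986] (4.3)–(4.5) p.670, (4.7)–(4.10) p.671, (4.25) and Lemma 4.4 (4.29)–(4.30) p.673.
-/

noncomputable section

open Complex Finset MeasureTheory intervalIntegral Filter Topology

namespace Summit.QuantumFields.YangMills.BalabanUVNodes.N15KingModelRung

open Literature.MathematicalPhysics.QuantumFieldTheory.King1986

/-! ## §1 The `η = 0` difference symbol `−iq` and the rate `‖η⁻¹(e^{−iηq} − 1) − (−iq)‖ ≤ η q²` -/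

section Fdq

/-- THE CONTINUUM DIFFERENCE SYMBOL: the `η → 0` value `−iq` of King's `D_η(q) = η⁻¹(e^{−iηq} − 1)` (the Fourier symbol of `−∂` replacing that of the backward
difference on the `η`-lattice). [cite: King1986, (4.3) p.670] -/
def fdq0 (q : ℝ) : ℂ := -(I * (q : ℂ))

/-- `‖−iq‖ = |q|`. [cite: King1986, (4.3) p.670] -/
theorem norm_fdq0 (q : ℝ) : ‖fdq0 q‖ = |q| := by
  unfold fdq0
  rw [norm_neg, norm_mul, Complex.norm_I, one_mul, Complex.norm_real, Real.norm_eq_abs]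

/-- `−iq ≠ 0` for `q ≠ 0`. [cite: King1986, (4.3) p.670] -/
theorem fdq0_ne_zero {q : ℝ} (hq : q ≠ 0) : fdq0 q ≠ 0 := by
  rw [← norm_pos_iff, norm_fdq0]
  exact abs_pos.mpr hq

/-- ★ **THE SPACING RATE AGAINST THE ENDPOINT**: `‖η⁻¹(e^{−iηq} − 1) − (−iq)‖ ≤ η·q²` for every `η > 0` and every real `q` — the `η′ = 0` case of the
tree's (4.25) kernel `norm_fdq_sub_fdq_le` (`‖D_{η′} − D_η‖ ≤ |η − η′|q²`), by the same integral representation `D_η(q) = (−iq)∫₀¹ e^{−iηqs} ds` against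
`−iq = (−iq)∫₀¹ 1 ds` and `|e^{ia} − 1| ≤ |a|`. [cite: King1986, (4.25) p.673] -/
theorem norm_fdq_sub_fdq0_le {η : ℝ} (hη : 0 < η) (q : ℝ) : ‖fdq η q - fdq0 q‖ ≤ η * q ^ 2 := by
  rcases eq_or_ne q 0 with hq | hq
  · subst hq
    simp [fdq, fdq0]
  rw [fdq_eq_integral hη.ne' hq]
  have h1 : fdq0 q = (-(I * q)) * ∫ _ in (0:ℝ)..1, (1 : ℂ) := by
    rw [intervalIntegral.integral_const, sub_zero, one_smul, mul_one]
    rfl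
  rw [h1, ← mul_sub]
  have hint : IntervalIntegrable (fun s : ℝ => Complex.exp ((I * ((-(η * q) : ℝ) : ℂ)) * s)) volume (0:ℝ) 1 :=
    (Complex.continuous_exp.comp (continuous_const.mul Complex.continuous_ofReal)).intervalIntegrable _ _
  rw [← intervalIntegral.integral_sub hint intervalIntegrable_const, norm_mul]
  have hb : ∀ s ∈ Set.uIoc (0:ℝ) 1, ‖Complex.exp ((I * ((-(η * q) : ℝ) : ℂ)) * s) - 1‖ ≤ η * |q| := by
    intro s hs
    rw [Set.uIoc_of_le zero_le_one] at hs
    have e1 : (I * ((-(η * q) : ℝ) : ℂ)) * s = I * (((-(η * q) * s : ℝ)) : ℂ) := by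
      push_cast; ring
    rw [e1]
    refine (Real.norm_exp_I_mul_ofReal_sub_one_le (x := -(η * q) * s)).trans ?_
    rw [Real.norm_eq_abs, abs_mul, abs_neg, abs_mul, abs_of_pos hη, abs_of_nonneg hs.1.le]
    calc η * |q| * s ≤ η * |q| * 1 := by gcongr; exact hs.2
      _ = η * |q| := mul_one _
  have hI := intervalIntegral.norm_integral_le_of_norm_le_const hb
  have hnq : ‖-(I * (q : ℂ))‖ = |q| := by simp
  rw [hnq]
  calc |q| * ‖∫ s in (0:ℝ)..1, (Complex.exp ((I * ((-(η * q) : ℝ) : ℂ)) * s) - 1)‖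
      ≤ |q| * (η * |q| * |1 - 0|) := mul_le_mul_of_nonneg_left hI (abs_nonneg q)
    _ = η * q ^ 2 := by rw [sub_zero, abs_one, mul_one, ← sq_abs q]; ring

/-- ★ `η⁻¹(e^{−iηq} − 1) → −iq` as `η → 0⁺`, every real `q`. [cite: King1986, (4.3) p.670, (4.25) p.673] -/
theorem tendsto_fdq_zero (q : ℝ) : Tendsto (fun η => fdq η q) (𝓝[>] 0) (𝓝 (fdq0 q)) := by
  rw [tendsto_iff_norm_sub_tendsto_zero]
  refine squeeze_zero' (g := fun η : ℝ => η * q ^ 2) (Eventually.of_forall fun η => norm_nonneg _) ?_ ?_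
  · filter_upwards [self_mem_nhdsWithin] with η hη using norm_fdq_sub_fdq0_le hη q
  · have h : Tendsto (fun η : ℝ => η * q ^ 2) (𝓝 0) (𝓝 (0 * q ^ 2)) := tendsto_id.mul_const _
    rw [zero_mul] at h
    exact h.mono_left nhdsWithin_le_nhds

end Fdq

/-! ## §2 One factor of `u⁰`: `(e^{−ix} − 1)∕(−ix)` -/

section Factor

/-- ONE COORDINATE OF THE CONTINUUM BLOCK FORM FACTOR: `f₀(x) = (e^{−ix} − 1)∕(−ix)` (the Fourier transform of the indicator of a unit interval), the removable
singularity at `x = 0` filled by its value `1` — the `η = 0` endpoint of King's `(e^{−ix} − 1)·η·(e^{−iηx} − 1)⁻¹` of (4.3). [cite: King1986, (4.3) p.670] -/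
def uFac0 (x : ℝ) : ℂ := if x = 0 then 1 else (Complex.exp (I * ((-x : ℝ) : ℂ)) - 1) / fdq0 x

/-- `|e^{−ix} − 1| ≤ |x|`. [cite: King1986, (4.20) p.672] -/
theorem norm_cexp_neg_sub_one_le (x : ℝ) : ‖Complex.exp (I * ((-x : ℝ) : ℂ)) - 1‖ ≤ |x| := by
  have h := (Real.norm_exp_I_mul_ofReal_sub_one_le (x := -x))
  rw [Real.norm_eq_abs, abs_neg] at h
  exact h

/-- `‖f₀(x)‖ ≤ 1`. [cite: King1986, (4.3) p.670, (4.20) p.672] -/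
theorem norm_uFac0_le (x : ℝ) : ‖uFac0 x‖ ≤ 1 := by
  unfold uFac0
  split_ifs with hx
  · simp
  · rw [norm_div, norm_fdq0, div_le_one (abs_pos.mpr hx)]
    exact norm_cexp_neg_sub_one_le x

/-- Comparability on the zone: `‖f₀(x)‖ ≤ ‖f_η(x)‖` for `η > 0`, `|ηx| ≤ π` (`‖D_η(x)‖ ≤ |x| = ‖D₀(x)‖`). [cite: King1986, (4.3) p.670, (4.25) p.673] -/
theorem norm_uFac0_le_norm_uFac {η x : ℝ} (hη : 0 < η) (hx : |η * x| ≤ Real.pi) : ‖uFac0 x‖ ≤ ‖uFac η x‖ := by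
  rcases eq_or_ne x 0 with h0 | h0
  · subst h0
    simp [uFac0, uFac]
  have hA : fdq η x ≠ 0 := fdq_ne_zero hη h0 hx
  unfold uFac0 uFac
  rw [if_neg h0, if_neg h0, norm_div, norm_div, norm_fdq0]
  exact div_le_div_of_nonneg_left (norm_nonneg _) (norm_pos_iff.mpr hA) (norm_fdq_le hη x)

/-- The endpoint relative-error identity: `f_η(x) − f₀(x) = f_η(x)·(D₀(x) − D_η(x))∕D₀(x)` (`x ≠ 0`, `D_η(x) ≠ 0`). [cite: King1986, (4.30) p.673] -/
theorem uFac_sub_uFac0 {η x : ℝ} (hx : x ≠ 0) (hA : fdq η x ≠ 0) :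
    uFac η x - uFac0 x = uFac η x * ((fdq0 x - fdq η x) / fdq0 x) := by
  have hB : fdq0 x ≠ 0 := fdq0_ne_zero hx
  unfold uFac uFac0
  simp only [hx, if_false]
  field_simp

/-- ★★ **LEMMA 4.4's ONE-COORDINATE STEP AT THE ENDPOINT `η′ = 0`**: for `η > 0` and `|ηx| ≤ π`, `‖f_η(x) − f₀(x)‖ ≤ η|x|·‖f_η(x)‖` (relative error `η|x|`,
constant `1`; from `‖D_η(x) − D₀(x)‖ ≤ ηx²` and `‖D₀(x)‖ = |x|`). [cite: King1986, Lemma 4.4 (4.29)–(4.30) p.673, (4.25) p.673] -/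
theorem norm_uFac_sub_uFac0_le {η x : ℝ} (hη : 0 < η) (hx : |η * x| ≤ Real.pi) :
    ‖uFac η x - uFac0 x‖ ≤ η * |x| * ‖uFac η x‖ := by
  rcases eq_or_ne x 0 with h0 | h0
  · subst h0
    simp [uFac, uFac0]
  have hA : fdq η x ≠ 0 := fdq_ne_zero hη h0 hx
  rw [uFac_sub_uFac0 h0 hA, norm_mul, norm_div, norm_fdq0]
  have hq : ‖fdq0 x - fdq η x‖ ≤ η * x ^ 2 := by
    rw [norm_sub_rev]
    exact norm_fdq_sub_fdq0_le hη x
  have hxpos : 0 < |x| := abs_pos.mpr h0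
  have hquot : ‖fdq0 x - fdq η x‖ / |x| ≤ η * |x| := by
    rw [div_le_iff₀ hxpos]
    calc ‖fdq0 x - fdq η x‖ ≤ η * x ^ 2 := hq
      _ = η * |x| * |x| := by rw [← sq_abs x]; ring
  calc ‖uFac η x‖ * (‖fdq0 x - fdq η x‖ / |x|) ≤ ‖uFac η x‖ * (η * |x|) :=
        mul_le_mul_of_nonneg_left hquot (norm_nonneg _)
    _ = η * |x| * ‖uFac η x‖ := by ring

/-- The same with the absolute constant: `‖f_η(x) − f₀(x)‖ ≤ (π∕2)·η|x|` on the zone (`‖f_η‖ ≤ π∕2`, tree `norm_uFac_le_half_pi`). [cite: King1986, (4.20) p.672, Lemma 4.4 (4.29) p.673] -/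
theorem norm_uFac_sub_uFac0_le' {η x : ℝ} (hη : 0 < η) (hx : |η * x| ≤ Real.pi) :
    ‖uFac η x - uFac0 x‖ ≤ Real.pi / 2 * (η * |x|) := by
  have h := norm_uFac_sub_uFac0_le hη hx
  have hb := norm_uFac_le_half_pi hη hx
  have h0 : 0 ≤ η * |x| := by positivity
  calc ‖uFac η x - uFac0 x‖ ≤ η * |x| * ‖uFac η x‖ := h
    _ ≤ η * |x| * (Real.pi / 2) := mul_le_mul_of_nonneg_left hb h0
    _ = Real.pi / 2 * (η * |x|) := by ring

/-- Eventually, along `η → 0⁺`, the spacing is positive and a fixed momentum coordinate lies in the zone `|ηx| ≤ π`. [cite: King1986, (4.2) p.670] -/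
theorem eventually_zone (x : ℝ) : ∀ᶠ η in 𝓝[>] (0 : ℝ), 0 < η ∧ |η * x| ≤ Real.pi := by
  have h1 : ∀ᶠ η in 𝓝[>] (0 : ℝ), 0 < η := eventually_mem_nhdsWithin
  have hc : Continuous fun η : ℝ => |η * x| := by fun_prop
  have h2 : ∀ᶠ η in 𝓝 (0 : ℝ), |η * x| ≤ Real.pi :=
    (hc.tendsto' 0 0 (by simp)).eventually (ge_mem_nhds Real.pi_pos)
  exact h1.and (h2.filter_mono nhdsWithin_le_nhds)

/-- ★ `f_η(x) → f₀(x)` as `η → 0⁺`, every real `x`. [cite: King1986, (4.3) p.670, Lemma 4.4 (4.29) p.673] -/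
theorem tendsto_uFac_zero (x : ℝ) : Tendsto (fun η => uFac η x) (𝓝[>] 0) (𝓝 (uFac0 x)) := by
  rw [tendsto_iff_norm_sub_tendsto_zero]
  refine squeeze_zero' (g := fun η : ℝ => Real.pi / 2 * (η * |x|)) (Eventually.of_forall fun η => norm_nonneg _) ?_ ?_
  · filter_upwards [eventually_zone x] with η hη using norm_uFac_sub_uFac0_le' hη.1 hη.2
  · have h : Tendsto (fun η : ℝ => Real.pi / 2 * (η * |x|)) (𝓝 0) (𝓝 (Real.pi / 2 * (0 * |x|))) :=
      (tendsto_id.mul_const _).const_mul _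
    rw [zero_mul, mul_zero] at h
    exact h.mono_left nhdsWithin_le_nhds

end Factor

/-! ## §3 The continuum block form factor `u⁰(p) = Π_μ f₀(p_μ)` and Lemma 4.4 at the endpoint -/

section Weight

variable {d : ℕ}

/-- THE CONTINUUM BLOCK FORM FACTOR `u⁰(p) = Π_{μ} (e^{−ip_μ} − 1)∕(−ip_μ)` — the Fourier transform of the indicator of the unit cube, the `η = 0` endpoint of
King's averaging weight (4.3). [cite: King1986, (4.3) p.670] -/
def uWeight0 (p : Fin d → ℝ) : ℂ := ∏ μ, uFac0 (p μ)

/-- `‖u⁰(p)‖ = Π_μ ‖f₀(p_μ)‖`. [cite: King1986, (4.3) p.670] -/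
theorem norm_uWeight0 (p : Fin d → ℝ) : ‖uWeight0 p‖ = ∏ μ, ‖uFac0 (p μ)‖ := norm_prod _ _

/-- `‖u⁰(p)‖ ≤ 1`. [cite: King1986, (4.3) p.670, (4.20) p.672] -/
theorem norm_uWeight0_le (p : Fin d → ℝ) : ‖uWeight0 p‖ ≤ 1 := by
  rw [norm_uWeight0]
  exact Finset.prod_le_one (fun μ _ => norm_nonneg _) fun μ _ => norm_uFac0_le (p μ)

/-- Comparability on the zone: `‖u⁰(p)‖ ≤ ‖u^η(p)‖` for `η > 0`, `|ηp_μ| ≤ π`. [cite: King1986, (4.3) p.670, (4.25) p.673] -/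
theorem norm_uWeight0_le_norm_uWeight {η : ℝ} (hη : 0 < η) {p : Fin d → ℝ} (hz : ∀ μ, |η * p μ| ≤ Real.pi) :
    ‖uWeight0 p‖ ≤ ‖uWeight η p‖ := by
  rw [norm_uWeight0, norm_uWeight]
  exact Finset.prod_le_prod (fun μ _ => norm_nonneg _) fun μ _ => norm_uFac0_le_norm_uFac hη (hz μ)

/-- ★★ **LEMMA 4.4 (4.29) AT THE ENDPOINT `η′ = 0`** (`γ = 1`, constant `1`): for `η > 0` and `p` in the zone `|ηp_μ| ≤ π`,
`‖u^η(p) − u⁰(p)‖ ≤ η·(Σ_μ |p_μ|)·‖u^η(p)‖` — King's product telescoping (tree `norm_prod_sub_prod_le_rel`) with relative errors `η|p_μ|` and comparability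
constant `K = 1`. [cite: King1986, Lemma 4.4 (4.29)–(4.30) p.673] -/
theorem norm_uWeight_sub_uWeight0_le {η : ℝ} (hη : 0 < η) {p : Fin d → ℝ} (hz : ∀ μ, |η * p μ| ≤ Real.pi) :
    ‖uWeight η p - uWeight0 p‖ ≤ η * (∑ μ, |p μ|) * ‖uWeight η p‖ := by
  unfold uWeight uWeight0
  rw [norm_prod]
  have h := norm_prod_sub_prod_le_rel (Finset.univ : Finset (Fin d)) (fun μ => uFac η (p μ)) (fun μ => uFac0 (p μ))
    (fun μ => η * |p μ|) (le_refl (1 : ℝ)) (fun μ _ => by positivity)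
    (fun μ _ => norm_uFac_sub_uFac0_le hη (hz μ)) (fun μ _ => by rw [one_mul]; exact norm_uFac0_le_norm_uFac hη (hz μ))
  rw [one_pow, one_mul, ← Finset.mul_sum] at h
  exact h

/-- The same with the absolute constant: `‖u^η(p) − u⁰(p)‖ ≤ (π∕2)^d·η·Σ_μ|p_μ|` on the zone. [cite: King1986, (4.20) p.672, Lemma 4.4 (4.29) p.673] -/
theorem norm_uWeight_sub_uWeight0_le' {η : ℝ} (hη : 0 < η) {p : Fin d → ℝ} (hz : ∀ μ, |η * p μ| ≤ Real.pi) :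
    ‖uWeight η p - uWeight0 p‖ ≤ (Real.pi / 2) ^ d * (η * ∑ μ, |p μ|) := by
  have h := norm_uWeight_sub_uWeight0_le hη hz
  have hb := norm_uWeight_le hη hz
  have h0 : 0 ≤ η * ∑ μ, |p μ| := mul_nonneg hη.le (Finset.sum_nonneg fun μ _ => abs_nonneg _)
  calc ‖uWeight η p - uWeight0 p‖ ≤ η * (∑ μ, |p μ|) * ‖uWeight η p‖ := h
    _ ≤ η * (∑ μ, |p μ|) * (Real.pi / 2) ^ d := mul_le_mul_of_nonneg_left hb h0
    _ = (Real.pi / 2) ^ d * (η * ∑ μ, |p μ|) := by ring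

/-- ★★ **`u^η(p) → u⁰(p)` as `η → 0⁺`**, every momentum `p` (product of the one-coordinate limits). [cite: King1986, (4.3) p.670, Lemma 4.4 (4.29) p.673] -/
theorem tendsto_uWeight_zero (p : Fin d → ℝ) : Tendsto (fun η => uWeight η p) (𝓝[>] 0) (𝓝 (uWeight0 p)) := by
  unfold uWeight uWeight0
  exact tendsto_finsetProd _ fun μ _ => tendsto_uFac_zero (p μ)

/-- ★ `‖u^η(p)‖² → ‖u⁰(p)‖²` as `η → 0⁺`. [cite: King1986, (4.3) p.670, (4.5) p.670] -/
theorem tendsto_norm_sq_uWeight_zero (p : Fin d → ℝ) :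
    Tendsto (fun η => ‖uWeight η p‖ ^ 2) (𝓝[>] 0) (𝓝 (‖uWeight0 p‖ ^ 2)) :=
  ((tendsto_uWeight_zero p).norm).pow 2

end Weight

/-! ## §4 The continuum symbol `|p|² + m²` of `Δ^η` -/

section Symbol

variable {d : ℕ}

/-- `m² ≤ Δ^η(p)` (every `η`, every `p`). [cite: King1986, (4.4) p.670, (4.8) p.671] -/
theorem mass_le_latticeSymbol (η M : ℝ) (p : Fin d → ℝ) : M ≤ latticeSymbol η M p := by
  unfold latticeSymbol
  have h : 0 ≤ ∑ μ, fdSymbol η (p μ) := Finset.sum_nonneg fun μ _ => fdSymbol_nonneg η (p μ)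
  linarith

/-- ★ **(4.10) TWO-SIDED**: on the zone `|ηp_μ| ≤ π`, `|Δ^η(p) − (|p|² + m²)| ≤ (η²∕12)·Σ_μ p_μ⁴` (the tree's `latticeSymbol_le` and `latticeSymbol_ge_quartic`).
[cite: King1986, (4.10) p.671] -/
theorem abs_latticeSymbol_sub_le {η : ℝ} (hη : η ≠ 0) (M : ℝ) {p : Fin d → ℝ} (hp : ∀ μ, |η * p μ| ≤ Real.pi) :
    |latticeSymbol η M p - (momSq p + M)| ≤ η ^ 2 / 12 * ∑ μ, p μ ^ 4 := by
  have h4 : 0 ≤ η ^ 2 / 12 * ∑ μ, p μ ^ 4 := by positivity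
  rw [abs_sub_le_iff]
  constructor
  · linarith [latticeSymbol_le hη M p]
  · linarith [latticeSymbol_ge_quartic hη M hp]

/-- Eventually, along `η → 0⁺`, the spacing is positive and a fixed momentum lies in the zone `|ηp_μ| ≤ π` for every `μ`. [cite: King1986, (4.2) p.670] -/
theorem eventually_zone_all (p : Fin d → ℝ) : ∀ᶠ η in 𝓝[>] (0 : ℝ), 0 < η ∧ ∀ μ, |η * p μ| ≤ Real.pi := by
  have h1 : ∀ᶠ η in 𝓝[>] (0 : ℝ), 0 < η := eventually_mem_nhdsWithin
  have h2 : ∀ᶠ η in 𝓝[>] (0 : ℝ), ∀ μ, |η * p μ| ≤ Real.pi :=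
    eventually_all.mpr fun μ => (eventually_zone (p μ)).mono fun η hη => hη.2
  exact h1.and h2

/-- ★★ **`Δ^η(p) → |p|² + m²` as `η → 0⁺`**, every momentum `p` and mass `m²`. [cite: King1986, (4.4) p.670, (4.10) p.671] -/
theorem tendsto_latticeSymbol_zero (M : ℝ) (p : Fin d → ℝ) :
    Tendsto (fun η => latticeSymbol η M p) (𝓝[>] 0) (𝓝 (momSq p + M)) := by
  rw [tendsto_iff_norm_sub_tendsto_zero]
  refine squeeze_zero' (g := fun η : ℝ => η ^ 2 / 12 * ∑ μ, p μ ^ 4) (Eventually.of_forall fun η => norm_nonneg _) ?_ ?_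
  · filter_upwards [eventually_zone_all p] with η hη
    rw [Real.norm_eq_abs]
    exact abs_latticeSymbol_sub_le hη.1.ne' M hη.2
  · have h : Tendsto (fun η : ℝ => η ^ 2 / 12 * ∑ μ, p μ ^ 4) (𝓝 0) (𝓝 ((0 : ℝ) ^ 2 / 12 * ∑ μ, p μ ^ 4)) :=
      ((tendsto_id.pow 2).div_const 12).mul_const _
    rw [zero_pow two_ne_zero, zero_div, zero_mul] at h
    exact h.mono_left nhdsWithin_le_nhds

/-- ★ `Δ^η(p)⁻¹ → (|p|² + m²)⁻¹` as `η → 0⁺` for `m² > 0`. [cite: King1986, (4.5) p.670, (4.7) p.671] -/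
theorem tendsto_inv_latticeSymbol_zero {M : ℝ} (hM : 0 < M) (p : Fin d → ℝ) :
    Tendsto (fun η => (latticeSymbol η M p)⁻¹) (𝓝[>] 0) (𝓝 ((momSq p + M)⁻¹)) := by
  have hne : momSq p + M ≠ 0 := by
    have := momSq_nonneg p
    positivity
  exact (tendsto_latticeSymbol_zero M p).inv₀ hne

end Symbol

end Summit.QuantumFields.YangMills.BalabanUVNodes.N15KingModelRung

end
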